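import Summits.KontsevichZagierPeriods.KontsevichZagierPeriods.Theorems.RootDecompRelativeModAbsoluteCylLogSplitP42

/-! # `RootDecompRelativeModAbsoluteCylLogSplitP43` — part 18/27 of the mechanical ≤400-line split of `RungClosure.lean` (sha256 f909f334226f0fb5…)
Source: decomp-kz lens-3 g12 `RungClosure.lean` v9 (HOME/decomp-kz-lens-3/g12/, sha256 f909f334…; critic g4-52/g4-57/g5 CLEARED, «lander: split v9 --supports 30572»): BLOCK I (57 g11 monolith decls missing from P01–P25), BLOCK II/III (WildCertAssembly parts 1–6, 8–10: `Leaf.cellLocalWildCert`, `Leaf.cylKernelZeroLog_of_trees`), Parts 12–13 (`Leaf.regKernelPairDegOne_iff_circlePos_of_trees`), BLOCK G13 (Möbius engine, test §C decided).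
Split by census-1 g9 `gen/splitlean.py`: scopes re-opened with their `open`/`variable`/`set_option` context; mathematics and declaration order unchanged. -/

noncomputable section
open Set MeasureTheory Filter Topology
open scoped BigOperators
open Literature.NumberTheory.Transcendental Literature.ModelTheory.ExponentialFields
namespace Summit.KontsevichZagierPeriods.RootDecompRelativeModAbsolute.Rung30571.RegularisedLogLayer.CylLog.Leaf

/-! ## Part 10 — T4 (g12): assembly of `CellLocalWildCert`

Geometry of the proof.  `exists_oneEnded_pieces_of_isSemialgebraic` cuts `E` (a.e.) into finitely many one-ended pieces
`P`, each an interval `(e, r)` / `(r, e)` with the rational end `r ∈ E` and the other end `e ∉ E` singular, or a ray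
`(-∞, r)` / `(r, +∞)`.  On each piece the coefficient functions, read on the line through the chart of Part 6
(reflection / `u ↦ r ∓ 1 ± u⁻¹`), become semialgebraic functions near the left end `a` of an interval `(a, c)`;
`end_analysis_left` extracts there the finite data `Z, m, δ, Cρ, lattice split, signs` of Part 9 together with an
EVENTUAL statement of the pointwise regime; a rational cut point `ρ` inside the eventual set splits `P` into the wild
end-piece (certificate by `wildCellCert_of_pointwise`) and a tame rest (coefficients bounded away from `0` on a compact
sub-interval of `E`, `Tame.tameCell_of_away`). -/

section T4

variable {q : ℕ}

/-! ### 10a. Small helpers -/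

/-- Auxiliary step `eq_const_fin1`: eq const fin1. [bookkeeping] -/
private theorem eq_const_fin1 (x : Fin 1 → ℝ) : x = fun _ => x 0 :=
  funext fun j => congrArg x (Subsingleton.elim j 0)

/-- Auxiliary step `zW_apply`: z W apply. [bookkeeping] -/
theorem zW_apply {b k : ℕ} (Z : Fin k → Bool) (W : Fin k → (Fin b → ℝ) → ℝ) (i : Fin k) (x : Fin b → ℝ) :
    zW Z W i x = if Z i = true then W i x else 1 := by
  unfold zW
  split_ifs <;> rfl

/-- Auxiliary step `isSemialgebraic_lt_rat`: is Semialgebraic lt rat. [bookkeeping] -/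
private theorem isSemialgebraic_lt_rat (r : ℚ) : IsSemialgebraic ℚ {w : Fin 1 → ℝ | w 0 < (r : ℝ)} := by
  simpa using isSemialgebraic_setOf_eval_lt (k := ℚ) (R := ℝ) (ι := Fin 1) (MvPolynomial.X 0) (MvPolynomial.C r)

/-- Auxiliary step `isSemialgebraic_rat_lt`: is Semialgebraic rat lt. [bookkeeping] -/
private theorem isSemialgebraic_rat_lt (r : ℚ) : IsSemialgebraic ℚ {w : Fin 1 → ℝ | (r : ℝ) < w 0} := by
  simpa using isSemialgebraic_setOf_eval_lt (k := ℚ) (R := ℝ) (ι := Fin 1) (MvPolynomial.C r) (MvPolynomial.X 0)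

/-- Auxiliary step `isSemialgebraic_Ioo_rat`: is Semialgebraic Ioo rat. [bookkeeping] -/
theorem isSemialgebraic_Ioo_rat (ρ r : ℚ) :
    IsSemialgebraic ℚ {w : Fin 1 → ℝ | w 0 ∈ Set.Ioo (ρ : ℝ) (r : ℝ)} := by
  have h := (isSemialgebraic_rat_lt ρ).inter (isSemialgebraic_lt_rat r)
  convert h using 1
  ext w
  simp only [Set.mem_setOf_eq, Set.mem_inter_iff, Set.mem_Ioo]

/-- Reflection `t ↦ -t` of an interval set. -/
theorem isSemialgebraic_reflect_Ioo {a c : ℝ} (hS : IsSemialgebraic ℚ {x : Fin 1 → ℝ | x 0 ∈ Set.Ioo a c}) :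
    IsSemialgebraic ℚ {x : Fin 1 → ℝ | x 0 ∈ Set.Ioo (-c) (-a)} := by
  have h := hS.preimage_aeval (fun _ : Fin 1 => -(MvPolynomial.X 0 : MvPolynomial (Fin 1) ℚ))
  convert h using 1
  ext x
  simp only [Set.mem_setOf_eq, Set.mem_preimage, Set.mem_Ioo, map_neg, MvPolynomial.aeval_X]
  constructor
  · rintro ⟨h1, h2⟩; exact ⟨by linarith, by linarith⟩
  · rintro ⟨h1, h2⟩; exact ⟨by linarith, by linarith⟩

/-- Reflection `t ↦ -t` of a semialgebraic function on a ray `(-∞, r)`. -/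
theorem isSemialgebraicFunOn_reflect_ray {φ : ℝ → ℝ} {r : ℝ}
    (hφ : IsSemialgebraicFunOn ℚ {x : Fin 1 → ℝ | x 0 < r} (fun x => φ (x 0))) :
    IsSemialgebraicFunOn ℚ {x : Fin 1 → ℝ | -r < x 0} (fun x => φ (-(x 0))) := by
  rw [isSemialgebraicFunOn_iff] at hφ ⊢
  have h := hφ.preimage_aeval
    (fun j : Fin 2 => if j = 0 then -(MvPolynomial.X 0 : MvPolynomial (Fin 2) ℚ) else MvPolynomial.X 1)
  convert h using 1
  ext z
  simp only [Set.mem_setOf_eq, Set.mem_preimage, Fin.init, Fin.isValue]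
  have h0 : (MvPolynomial.aeval z) (if (Fin.castSucc (0 : Fin 1) : Fin 2) = 0 then
      -(MvPolynomial.X 0 : MvPolynomial (Fin 2) ℚ) else MvPolynomial.X 1) = -(z 0) := by
    simp
  have h1 : (MvPolynomial.aeval z) (if (Fin.last 1 : Fin 2) = 0 then
      -(MvPolynomial.X 0 : MvPolynomial (Fin 2) ℚ) else MvPolynomial.X 1) = z 1 := by
    simp
  simp only [h0, h1]
  constructor
  · rintro ⟨ha, hb⟩
    refine ⟨?_, by simpa using hb⟩
    simp only [Fin.castSucc_zero] at ha ⊢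
    linarith
  · rintro ⟨ha, hb⟩
    refine ⟨?_, by simpa using hb⟩
    simp only [Fin.castSucc_zero] at ha ⊢
    linarith

/-- A uniform positive lower bound for finitely many continuous nonvanishing functions on a compact set. -/
theorem exists_uniform_away (κL : Fin q → ℝ → ℝ) (σ : Fin q → Fin 3) {K : Set ℝ} (hK : IsCompact K)
    (hcont : ∀ i, ContinuousOn (κL i) K) (h0 : ∀ i, σ i ≠ 2 → ∀ t ∈ K, κL i t ≠ 0) :
    ∃ δ : ℝ, 0 < δ ∧ ∀ i, σ i ≠ 2 → ∀ t ∈ K, δ ≤ |κL i t| := by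
  classical
  have hi : ∀ i, ∃ δ : ℝ, 0 < δ ∧ (σ i ≠ 2 → ∀ t ∈ K, δ ≤ |κL i t|) := by
    intro i
    by_cases h2 : σ i = 2
    · exact ⟨1, one_pos, fun h => absurd h2 h⟩
    rcases K.eq_empty_or_nonempty with hKe | hne
    · exact ⟨1, one_pos, fun _ t ht => by simp [hKe] at ht⟩
    obtain ⟨t₀, ht₀, hmin⟩ := hK.exists_isMinOn hne (continuous_abs.comp_continuousOn (hcont i))
    exact ⟨|κL i t₀|, abs_pos.2 (h0 i h2 t₀ ht₀), fun _ t ht => (isMinOn_iff.1 hmin) t ht⟩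
  choose δ hδ hP using hi
  have hsum0 : 0 ≤ ∑ j, 1 / δ j := Finset.sum_nonneg fun j _ => (one_div_pos.2 (hδ j)).le
  refine ⟨1 / (1 + ∑ j, 1 / δ j), div_pos one_pos (by linarith), fun i h2 t ht => ?_⟩
  have h1 : 1 / (1 + ∑ j, 1 / δ j) ≤ δ i := by
    rw [div_le_iff₀ (by linarith)]
    have hs : 1 / δ i ≤ ∑ j, 1 / δ j :=
      Finset.single_le_sum (f := fun j => 1 / δ j) (fun j _ => (one_div_pos.2 (hδ j)).le) (Finset.mem_univ i)
    calc (1 : ℝ) = δ i * (1 / δ i) := by rw [mul_one_div, div_self (hδ i).ne']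
      _ ≤ δ i * (1 + ∑ j, 1 / δ j) := mul_le_mul_of_nonneg_left (by linarith) (hδ i).le
  exact h1.trans (hP i h2 t ht)

/-! ### 10b. The end regime and the end package -/

/-- The sign product `∏_{Z i} (1 + v i)^{(g s i)⁺}` whose position w.r.t. `1` is recorded by the sign bit `L s`. -/
def sgnProd {q na : ℕ} (Z : Fin q → Bool) (g : Fin na → Fin q → ℤ) (s : Fin na) (v : Fin q → ℝ) : ℝ :=
  ∏ i, (if Z i = true then 1 + v i else 1) ^ (g s i).toNat

/-- The pointwise regime required by `wildCellCert_of_pointwise`, as a predicate on the value vector `v = (κ i x)_i`. -/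
def EndRegime {q na : ℕ} (σ : Fin q → Fin 3) (M : Fin q → ℕ) (Z : Fin q → Bool) (m : ℕ) (δ Cρ : ℝ)
    (g : Fin na → Fin q → ℤ) (L : Fin na → Bool) (v : Fin q → ℝ) : Prop :=
  (∀ i, Z i = true → |v i| ≤ 1 / 2) ∧ (∀ i, Z i = false → σ i ≠ 2 → δ ≤ |v i|) ∧
  (∀ i k, Z i = true → Z k = true → |v i| ^ (m + 1) ≤ Cρ * |v k| ^ (M k + 1)) ∧
  (∀ s, (L s = true → 1 ≤ sgnProd Z g s v) ∧ (L s = false → sgnProd Z g s v ≤ 1))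

/-- The seven clauses of `latticeSplitΓ`, packaged. -/
def LatticeData (q R : ℕ) (f : Fin R → Fin q → ℤ) (Z : Fin q → Bool) (na nb : ℕ) (g : Fin na → Fin q → ℤ)
    (h : Fin nb → Fin q → ℤ) (A : Fin na → Fin R → ℚ) (B : Fin nb → Fin R → ℚ) (β : Fin nb → Fin q → ℚ)
    (α : Fin na → Fin q → ℚ) : Prop :=
  (∀ s i, Z i = false → g s i = 0) ∧
  (∀ s, ∃ N : ℕ, 0 < N ∧ ∃ z : Fin R → ℤ, ∀ i, (N : ℤ) * g s i = ∑ r, z r * f r i) ∧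
  (∀ t, ∃ N : ℕ, 0 < N ∧ ∃ z : Fin R → ℤ, ∀ i, (N : ℤ) * h t i = ∑ r, z r * f r i) ∧
  (∀ t k, Z k = true → β t k = 0) ∧
  (∀ r i, (f r i : ℚ) = ∑ s, A s r * g s i + ∑ t, B t r * h t i) ∧
  (∀ t r, B t r = ∑ k, β t k * f r k) ∧
  (∀ s r, A s r = ∑ k, α s k * f r k)

/-- The finite end data (lattice split, `Z, m, δ, Cρ`, signs) together with the regime statement in the form `Φ`
(`Φ Q` = "`Q` holds eventually at the end" resp. "`Q` holds at every point of the end-piece"). -/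
def EndPackage (q R : ℕ) (f : Fin R → Fin q → ℤ) (σ : Fin q → Fin 3) (M : Fin q → ℕ)
    (Φ : ((Fin q → ℝ) → Prop) → Prop) : Prop :=
  ∃ (Z : Fin q → Bool) (m : ℕ) (δ Cρ : ℝ) (na nb : ℕ) (g : Fin na → Fin q → ℤ) (h : Fin nb → Fin q → ℤ)
    (A : Fin na → Fin R → ℚ) (B : Fin nb → Fin R → ℚ) (β : Fin nb → Fin q → ℚ) (α : Fin na → Fin q → ℚ)
    (L : Fin na → Bool),
    LatticeData q R f Z na nb g h A B β α ∧ 0 < δ ∧ 0 ≤ Cρ ∧ (∀ i, Z i = true → σ i ≠ 2) ∧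
      (∀ i, Z i = true → M i ≤ m) ∧ Φ (EndRegime σ M Z m δ Cρ g L)

/-- Auxiliary step `mono`: mono. [bookkeeping] -/
theorem EndPackage.mono {q R : ℕ} {f : Fin R → Fin q → ℤ} {σ : Fin q → Fin 3} {M : Fin q → ℕ}
    {Φ Ψ : ((Fin q → ℝ) → Prop) → Prop} (hΦΨ : ∀ Q, Φ Q → Ψ Q) (h : EndPackage q R f σ M Φ) :
    EndPackage q R f σ M Ψ := by
  obtain ⟨Z, m, δ, Cρ, na, nb, g, h, A, B, β, α, L, hLD, hδ, hCρ, hZσ, hZM, hreg⟩ := h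
  exact ⟨Z, m, δ, Cρ, na, nb, g, h, A, B, β, α, L, hLD, hδ, hCρ, hZσ, hZM, hΦΨ _ hreg⟩

/-! ### 10c. The end analysis at a left end -/

/-- **End analysis.**  Semialgebraic functions `φ i` on `(a, c)`, continuous on `(a, c]` and nonvanishing there for
`σ i ≠ 2`: the finite data of Part 9 exist and the pointwise regime holds eventually at `a⁺`. -/
theorem end_analysis_left (φ : Fin q → ℝ → ℝ) (M : Fin q → ℕ) (σ : Fin q → Fin 3) {a c : ℝ} (hac : a < c)
    (hS : IsSemialgebraic ℚ {x : Fin 1 → ℝ | x 0 ∈ Set.Ioo a c})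
    (hφ : ∀ i, IsSemialgebraicFunOn ℚ {x : Fin 1 → ℝ | x 0 ∈ Set.Ioo a c} (fun x => φ i (x 0)))
    (hcont : ∀ i, ContinuousOn (φ i) (Set.Ioc a c)) (hne : ∀ i, σ i ≠ 2 → ∀ t ∈ Set.Ioc a c, φ i t ≠ 0)
    {R : ℕ} (f : Fin R → Fin q → ℤ) :
    EndPackage q R f σ M (fun Q => ∀ᶠ t in 𝓝[>] a, Q (fun i => φ i t)) := by
  classical
  -- the subfamily `Z` of coefficient functions tending to `0` at the end
  set Z : Fin q → Bool := fun i => decide (σ i ≠ 2 ∧ Tendsto (φ i) (𝓝[>] a) (𝓝 0)) with hZdef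
  have hZσ : ∀ i, Z i = true → σ i ≠ 2 := by
    intro i hi
    simp only [hZdef, decide_eq_true_eq] at hi
    exact hi.1
  have hZt : ∀ i, Z i = true → Tendsto (φ i) (𝓝[>] a) (𝓝 0) := by
    intro i hi
    simp only [hZdef, decide_eq_true_eq] at hi
    exact hi.2
  have hZf : ∀ i, Z i = false → σ i ≠ 2 → ∃ δ : ℝ, 0 < δ ∧ ∀ t ∈ Set.Ioc a c, δ ≤ |φ i t| := by
    intro i hi h2
    rcases CylLogLeaf.left_end_dichotomy hac (hφ i) (hcont i) (hne i h2) with ⟨ht, -⟩ | h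
    · have : Z i = true := by
        simp only [hZdef, decide_eq_true_eq]
        exact ⟨h2, ht⟩
      rw [hi] at this
      exact absurd this Bool.false_ne_true
    · exact h
  -- a uniform `δ` for the functions off `Z`
  have hδi : ∀ i, ∃ δ : ℝ, 0 < δ ∧ (Z i = false → σ i ≠ 2 → ∀ t ∈ Set.Ioc a c, δ ≤ |φ i t|) := by
    intro i
    by_cases hi : Z i = false
    · by_cases h2 : σ i = 2
      · exact ⟨1, one_pos, fun _ h => absurd h2 h⟩
      · obtain ⟨δ, hδ, h⟩ := hZf i hi h2
        exact ⟨δ, hδ, fun _ _ => h⟩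
    · exact ⟨1, one_pos, fun h => absurd h hi⟩
  choose δi hδi0 hδiP using hδi
  have hsum0 : 0 ≤ ∑ j, 1 / δi j := Finset.sum_nonneg fun j _ => (one_div_pos.2 (hδi0 j)).le
  have hδle : ∀ i, 1 / (1 + ∑ j, 1 / δi j) ≤ δi i := by
    intro i
    rw [div_le_iff₀ (by linarith)]
    have hs : 1 / δi i ≤ ∑ j, 1 / δi j :=
      Finset.single_le_sum (f := fun j => 1 / δi j) (fun j _ => (one_div_pos.2 (hδi0 j)).le) (Finset.mem_univ i)
    calc (1 : ℝ) = δi i * (1 / δi i) := by rw [mul_one_div, div_self (hδi0 i).ne']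
      _ ≤ δi i * (1 + ∑ j, 1 / δi j) := mul_le_mul_of_nonneg_left (by linarith) (hδi0 i).le
  -- comparison exponent `m` and ratio constant `Cρ` on `Z`
  obtain ⟨m₀, δr, hδr, -, hδrc, -, hr⟩ := CylLogLeaf.rates_at_end (ι := {i : Fin q // Z i = true})
    (fun i => φ i.1) (fun i => M i.1) hac (fun i => hφ i.1) (fun i => hZt i.1 i.2)
    (fun i t ht => hne i.1 (hZσ i.1 i.2) t ⟨ht.1, ht.2.le⟩)
  have hMm : ∀ i, M i ≤ max m₀ (Finset.univ.sup M) := fun i =>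
    (Finset.le_sup (f := M) (Finset.mem_univ i)).trans (le_max_right _ _)
  choose Cik hCik using hr (max m₀ (Finset.univ.sup M)) (le_max_left _ _)
  have hCρ0 : 0 ≤ ∑ i, ∑ k, |Cik i k| :=
    Finset.sum_nonneg fun i _ => Finset.sum_nonneg fun k _ => abs_nonneg _
  have hCle : ∀ i k, Cik i k ≤ ∑ i', ∑ k', |Cik i' k'| := by
    intro i k
    calc Cik i k ≤ |Cik i k| := le_abs_self _
      _ ≤ ∑ k', |Cik i k'| :=
          Finset.single_le_sum (f := fun k' => |Cik i k'|) (fun _ _ => abs_nonneg _) (Finset.mem_univ k)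
      _ ≤ ∑ i', ∑ k', |Cik i' k'| :=
          Finset.single_le_sum (f := fun i' => ∑ k', |Cik i' k'|)
            (fun _ _ => Finset.sum_nonneg fun _ _ => abs_nonneg _) (Finset.mem_univ i)
  -- the lattice split relative to `Z`
  obtain ⟨na, nb, g, h, A, B, β, α, h1, h2, h3, h4, h5, h6, h7⟩ := latticeSplitΓ q R f Z
  -- the sign of each product `∏_{Z i} (1 + φ i)^{(g s i)⁺}` near the end
  have h1c : IsSemialgebraicFunOn ℚ {x : Fin 1 → ℝ | x 0 ∈ Set.Ioo a c} (fun _ => (1 : ℝ)) :=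
    (isSemialgebraicFunOn_const_natCast hS 1).congr fun _ _ => by simp
  have hsign : ∀ s : Fin na, ∃ (side : Bool) (v : ℝ), a < v ∧ ∀ t ∈ Set.Ioo a v,
      (side = true → 1 ≤ sgnProd Z g s (fun i => φ i t)) ∧
        (side = false → sgnProd Z g s (fun i => φ i t) ≤ 1) := by
    intro s
    have hFsa : IsSemialgebraicFunOn ℚ {x : Fin 1 → ℝ | x 0 ∈ Set.Ioo a c}
        (fun x => sgnProd Z g s (fun i => φ i (x 0))) := by
      show IsSemialgebraicFunOn ℚ {x : Fin 1 → ℝ | x 0 ∈ Set.Ioo a c}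
        (fun x => ∏ i, (if Z i = true then 1 + φ i (x 0) else 1) ^ (g s i).toNat)
      refine IsSemialgebraicFunOn.fun_finsetProd Finset.univ hS fun i _ => ?_
      by_cases hi : Z i = true
      · exact ((h1c.fun_add (hφ i)).fun_pow ((g s i).toNat)).congr fun x _ => by simp [hi]
      · exact ((h1c.fun_pow ((g s i).toNat))).congr fun x _ => by simp [hi]
    obtain ⟨sset, hss, hcell⟩ :=
      semialgebraic_monotonicity_holds a c (fun t => sgnProd Z g s (fun i => φ i t)) hac hFsa
    have hv : ∃ v, a < v ∧ (v = c ∨ v ∈ sset) ∧ ∀ x ∈ sset, x ∉ Set.Ioo a v := by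
      by_cases hsne : sset.Nonempty
      · refine ⟨sset.min' hsne, (hss (sset.min'_mem hsne)).1, Or.inr (sset.min'_mem hsne), fun x hx hxI => ?_⟩
        exact absurd hxI.2 (not_lt.2 (sset.min'_le x hx))
      · exact ⟨c, hac, Or.inl rfl, fun x hx => absurd ⟨x, hx⟩ hsne⟩
    obtain ⟨v, hav, hvc, hnov⟩ := hv
    rcases hcell a v hav (Or.inl rfl) hvc hnov with ⟨K, hK⟩ | ⟨hmono, -⟩
    · by_cases hK1 : 1 ≤ K
      · refine ⟨true, v, hav, fun t ht => ⟨fun _ => ?_, fun h => absurd h (by simp)⟩⟩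
        have hFt : sgnProd Z g s (fun i => φ i t) = K := hK ht
        rw [hFt]; exact hK1
      · refine ⟨false, v, hav, fun t ht => ⟨fun h => absurd h (by simp), fun _ => ?_⟩⟩
        have hFt : sgnProd Z g s (fun i => φ i t) = K := hK ht
        rw [hFt]; exact (not_le.1 hK1).le
    · rcases hmono with hmono | hanti
      · by_cases hex : ∃ t₀ ∈ Set.Ioo a v, sgnProd Z g s (fun i => φ i t₀) ≤ 1
        · obtain ⟨t₀, ht₀, hF0⟩ := hex
          refine ⟨false, t₀, ht₀.1, fun t ht => ⟨fun h => absurd h (by simp), fun _ => ?_⟩⟩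
          have ht' : t ∈ Set.Ioo a v := ⟨ht.1, ht.2.trans ht₀.2⟩
          have hlt : sgnProd Z g s (fun i => φ i t) < sgnProd Z g s (fun i => φ i t₀) := hmono ht' ht₀ ht.2
          exact hlt.le.trans hF0
        · simp only [not_exists, not_and, not_le] at hex
          exact ⟨true, v, hav, fun t ht => ⟨fun _ => (hex t ht).le, fun h => absurd h (by simp)⟩⟩
      · by_cases hex : ∃ t₀ ∈ Set.Ioo a v, 1 ≤ sgnProd Z g s (fun i => φ i t₀)
        · obtain ⟨t₀, ht₀, hF0⟩ := hex
          refine ⟨true, t₀, ht₀.1, fun t ht => ⟨fun _ => ?_, fun h => absurd h (by simp)⟩⟩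
          have ht' : t ∈ Set.Ioo a v := ⟨ht.1, ht.2.trans ht₀.2⟩
          have hlt : sgnProd Z g s (fun i => φ i t₀) < sgnProd Z g s (fun i => φ i t) := hanti ht' ht₀ ht.2
          exact hF0.trans hlt.le
        · simp only [not_exists, not_and, not_le] at hex
          exact ⟨false, v, hav, fun t ht => ⟨fun h => absurd h (by simp), fun _ => (hex t ht).le⟩⟩
  choose L v hav hLv using hsign
  refine ⟨Z, max m₀ (Finset.univ.sup M), 1 / (1 + ∑ j, 1 / δi j), ∑ i, ∑ k, |Cik i k|, na, nb, g, h, A, B,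
    β, α, L, ⟨h1, h2, h3, h4, h5, h6, h7⟩, div_pos one_pos (by linarith), hCρ0, hZσ, fun i _ => hMm i, ?_⟩
  -- the four eventualities
  have e1 : ∀ i, ∀ᶠ t in 𝓝[>] a, Z i = true → |φ i t| ≤ 1 / 2 := by
    intro i
    by_cases hi : Z i = true
    · have hev := Metric.tendsto_nhds.1 (hZt i hi) (1 / 2) (by norm_num)
      exact hev.mono fun t ht _ => by rw [Real.dist_eq, sub_zero] at ht; exact ht.le
    · exact Filter.Eventually.of_forall fun t h => absurd h hi
  have e2 : ∀ᶠ t in 𝓝[>] a, ∀ i, Z i = false → σ i ≠ 2 → 1 / (1 + ∑ j, 1 / δi j) ≤ |φ i t| := by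
    filter_upwards [Ioc_mem_nhdsGT hac] with t ht i hi h2
    exact (hδle i).trans (hδiP i hi h2 t ht)
  have e3 : ∀ᶠ t in 𝓝[>] a, ∀ i k, Z i = true → Z k = true →
      |φ i t| ^ (max m₀ (Finset.univ.sup M) + 1) ≤ (∑ i', ∑ k', |Cik i' k'|) * |φ k t| ^ (M k + 1) := by
    filter_upwards [Ioo_mem_nhdsGT (show a < a + δr by linarith)] with t ht i k hi hk
    have hq := hCik ⟨i, hi⟩ ⟨k, hk⟩ t ht
    have hpos : 0 < |φ k t| ^ (M k + 1) :=
      pow_pos (abs_pos.2 (hne k (hZσ k hk) t ⟨ht.1, ht.2.le.trans hδrc⟩)) _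
    rw [div_le_iff₀ hpos] at hq
    exact hq.trans (mul_le_mul_of_nonneg_right (hCle _ _) hpos.le)
  have e4 : ∀ s, ∀ᶠ t in 𝓝[>] a, (L s = true → 1 ≤ sgnProd Z g s (fun i => φ i t)) ∧
      (L s = false → sgnProd Z g s (fun i => φ i t) ≤ 1) := fun s => by
    filter_upwards [Ioo_mem_nhdsGT (hav s)] with t ht
    exact hLv s t ht
  filter_upwards [eventually_all.2 e1, e2, e3, eventually_all.2 e4] with t k1 k2 k3 k4
  exact ⟨k1, k2, k3, k4⟩

end T4

section T4split

variable {q : ℕ}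

/-! ### 10d. Splitting a piece into a wild end-piece and a tame rest -/

/-- The cell-level hypotheses of `CellLocalWildCert` that the assembly uses, bundled. -/
structure CellHyps (q : ℕ) (E : Set (Fin 1 → ℝ)) (c κ : Fin q → (Fin 1 → ℝ) → ℝ) (M : Fin q → ℕ)
    (σ : Fin q → Fin 3) (R : ℕ) (f : Fin R → Fin q → ℤ) (qq : Fin R → (Fin 1 → ℝ) → ℝ) : Prop where
  hEo : IsOpen E
  hE : IsSemialgebraic ℚ E
  hc : ∀ i, IsSemialgebraicFunOn ℚ E (c i)
  hκ : ∀ i, IsSemialgebraicFunOn ℚ E (κ i)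
  hκc : ∀ i, ContinuousOn (κ i) E
  hκ1 : ∀ i, ∀ x ∈ E, -1 < κ i x
  hσ0 : ∀ i, σ i = 0 → ∀ x ∈ E, 0 < κ i x
  hσ1 : ∀ i, σ i = 1 → ∀ x ∈ E, κ i x < 0
  hσ2 : ∀ i, σ i = 2 → ∀ x ∈ E, κ i x = 0
  hL1 : ∀ i, IntegrableOn (fun x => c i x * ∫ θ in Set.Ioo (0 : ℝ) 1, θ ^ M i / (1 + θ * κ i x)) E
  hqq : ∀ r, IsSemialgebraicFunOn ℚ E (qq r)
  hprod : ∀ r, ∀ x ∈ E, ∏ i, (1 + κ i x) ^ (f r i) = 1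
  hcoef : ∀ i, ∀ x ∈ E, logCoef (sgnB σ) c κ M i x = ∑ r, qq r x * (f r i : ℝ)

end T4split
end Summit.KontsevichZagierPeriods.RootDecompRelativeModAbsolute.Rung30571.RegularisedLogLayer.CylLog.Leaf
end
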